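import Summits.CriticalPhenomena.PercolationContinuityZ3.Theorems.PercNearOneGluingNoHeavyLowerTailHullPortTANDefs
import Summits.CriticalPhenomena.PercolationContinuityZ3.Theorems.PercNearOneGluingNoHeavyLowerTailHullPortTABase
import HarnessLib

/-!
# `NoHeavyLowerTail` (stmt-CriticalPhenomena-4575) — set-observer `T_A`: one-edge sections, degenerate cases, base case

Support file (prover `prim-hp-7`; `--supports stmt-CriticalPhenomena-4575`); no definitions, named facts or sorries.
Part 1 of the Lean proof of the SET-OBSERVER version of prim-hp-7's `T_A ≥ 0` (definitions: `…HullPortTANDefs`;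
cell memos HP7-MDLX-PROOF.md §3, §5 and prim-cplus-coupling A5-COUPLING-gen13.md §4; blueprint step B2 towards
Kozma–Nitzan's Question 9 at `|A| = 3`), verbatim along `…HullPortTASections` / `…HullPortTABase`:
* `HullPort.taAN_section`, `HullPort.taaN_section` — resampling one boundary pair `e = {x₀, v}`, `x₀ ∈ X`:
  `F_X(w) = (1 − w e) F_X(w[e↦0]) + (w e) F_{X∪{v}}(w[e↦0])` for `F = A^N, a^N` (`B`, `b`: `…HullPortTASections`);
* degenerate cases (`y ∈ X`, `s ∈ X`);
* `HullPort.taQN_eq_zero_of_noBoundary` — the BASE CASE: with no positive pair leaving `X`, `Q^N = A^N·b − a^N·B = 0`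
  (the cut set is constant, `{N ↮ X} = {N ∩ X = ∅}` is the loop indicator `avoidCut`, and `taNWN/taN = a^N/b`).
[cite: VandenbergHaggstromKahn2005, §1 pp. 3–5 — bookkeeping in the induced model; cell memo HP7-MDLX-PROOF §5]
-/

noncomputable section

namespace Summit.CriticalPhenomena.PercolationContinuityZ3.Theorems

open MeasureTheory Set Literature.Probability.LatticeModels Literature.Probability.Percolation
open scoped Classical

variable {V : Type*}

namespace HullPort

open LonePortSum LonePortSumGeneral BHK2006 DecisionTree KNPreFKG

section TAN

variable [Fintype V]


/-- **Section identity for `A^N`**: `A^N_X(w) = (1 − w e) A^N_X(w₀) + (w e) A^N_{X∪{v}}(w₀)`, `e = {x₀, v}`, `x₀ ∈ X`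
(the integrand depends on `ω` only through the cut set, and on the weights only off it). [folklore] -/
theorem taAN_section (w w₀ : Sym2 V → ℝ) (s y : V) (N : Set V) (x₀ v : V) (X : Set V) (hx₀ : x₀ ∈ X)
    (he0 : w₀ s(x₀, v) = 0) (hoff : ∀ f, f ≠ s(x₀, v) → w₀ f = w f) (g : Set (Sym2 V) → ℝ) :
    taAN w s y N X g = (1 - w s(x₀, v)) * taAN w₀ s y N X g + w s(x₀, v) * taAN w₀ s y N (insert v X) g := by
  have key := section_generic w w₀ s x₀ v X hx₀ he0 hoff
    (fun w' B => ind (avoidCut N) B *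
        delE w' B (ind ((openConn s y : Set (BondConfig V))ᶜ ∩ (connS N y ∩ sepEv N {s}))) /
        delE w' B (ind (openConn s y : Set (BondConfig V))ᶜ) *
      (delE w' B (fun η => g (openEdgeCluster η s) * ind (openConn s y) η) -
        delE w' B (fun η => g (openEdgeCluster η s)) * delE w' B (ind (openConn s y))))
    (fun w w' B h => by simp only [delE_congr_of_mem h])
  simpa only [taAN, taC, taN, taNWN] using key

omit [Fintype V] in
/-- Adding the edge `{x₀, v}` (`x₀ ∈ T`): the event `{y ↮ T, y ↔ N, N ↮ T}` afterwards is the event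
`{y ↮ T ∪ {v}, y ↔ N, N ↮ T ∪ {v}}` before. [folklore] -/
theorem insert_mem_taaNEv_iff (y x₀ v : V) (N T : Set V) (hx₀ : x₀ ∈ T) (ω : Set (Sym2 V)) :
    insert s(x₀, v) ω ∈ avoidEv y T ∩ (connS N y ∩ sepEv N T) ↔
      ω ∈ avoidEv y (insert v T) ∩ (connS N y ∩ sepEv N (insert v T)) := by
  constructor
  · rintro ⟨h1, ⟨n, hn, hyn⟩, h3⟩
    have h1' : ω ∈ avoidEv y (insert v T) := (insert_mem_avoidEv_iff y x₀ v T hx₀ ω).1 h1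
    refine ⟨h1', ⟨n, hn, (reachable_insert_edge_iff_of_avoid y x₀ v n T hx₀ ω h1').1 hyn⟩, ?_⟩
    intro n' hn'
    have h3' : insert s(x₀, v) ω ∈ avoidEv n' T := fun t ht => h3 n' hn' t ht
    exact (insert_mem_avoidEv_iff n' x₀ v T hx₀ ω).1 h3'
  · rintro ⟨h1, ⟨n, hn, hyn⟩, h3⟩
    have h1' : insert s(x₀, v) ω ∈ avoidEv y T := (insert_mem_avoidEv_iff y x₀ v T hx₀ ω).2 h1
    refine ⟨h1', ⟨n, hn, hyn.mono (openGraph_le (Set.subset_insert _ _))⟩, ?_⟩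
    intro n' hn'
    have h3' : ω ∈ avoidEv n' (insert v T) := fun t ht => h3 n' hn' t ht
    exact (insert_mem_avoidEv_iff n' x₀ v T hx₀ ω).2 h3'

/-- Section identity for the mass of `{y ↮ T, y ↔ N, N ↮ T}` (`x₀ ∈ T`):
`μ_w(E_T) = (1 − w e) μ_{w₀}(E_T) + (w e) μ_{w₀}(E_{T ∪ {v}})`. [folklore] -/
theorem taaNEv_section (w w₀ : Sym2 V → ℝ) (y : V) (N : Set V) (x₀ v : V) (T : Set V) (hx₀ : x₀ ∈ T)
    (he0 : w₀ s(x₀, v) = 0) (hoff : ∀ f, f ≠ s(x₀, v) → w₀ f = w f) :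
    ∑ ω, weight w ω * ind (avoidEv y T ∩ (connS N y ∩ sepEv N T)) ω =
      (1 - w s(x₀, v)) * ∑ ω, weight w₀ ω * ind (avoidEv y T ∩ (connS N y ∩ sepEv N T)) ω +
        w s(x₀, v) * ∑ ω, weight w₀ ω * ind (avoidEv y (insert v T) ∩ (connS N y ∩ sepEv N (insert v T))) ω := by
  classical
  rw [sum_weight_resample w w₀ s(x₀, v) he0 hoff]
  simp only [mul_add, Finset.sum_add_distrib]
  congr 1
  · have h1 := sum_weight_mul_comp_sdiff_singleton_of_zero w₀ s(x₀, v) he0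
      (fun ζ => (1 - w s(x₀, v)) * ind (avoidEv y T ∩ (connS N y ∩ sepEv N T)) ζ)
    rw [h1, Finset.mul_sum]
    refine Finset.sum_congr rfl fun η _ => ?_
    ring
  · rw [Finset.mul_sum]
    refine Finset.sum_congr rfl fun η _ => ?_
    have hD : ind (avoidEv y T ∩ (connS N y ∩ sepEv N T)) (insert s(x₀, v) η) =
        ind (avoidEv y (insert v T) ∩ (connS N y ∩ sepEv N (insert v T))) η := by
      by_cases h : η ∈ avoidEv y (insert v T) ∩ (connS N y ∩ sepEv N (insert v T))
      · rw [ind_of_mem h, ind_of_mem ((insert_mem_taaNEv_iff y x₀ v N T hx₀ η).2 h)]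
      · rw [ind_of_not_mem h, ind_of_not_mem fun h' => h ((insert_mem_taaNEv_iff y x₀ v N T hx₀ η).1 h')]
    rw [hD]; ring

/-- **Section identity for `a^N`**. [folklore] -/
theorem taaN_section (w w₀ : Sym2 V → ℝ) (s y : V) (N : Set V) (x₀ v : V) (X : Set V) (hx₀ : x₀ ∈ X)
    (he0 : w₀ s(x₀, v) = 0) (hoff : ∀ f, f ≠ s(x₀, v) → w₀ f = w f) :
    taaN w s y N X = (1 - w s(x₀, v)) * taaN w₀ s y N X + w s(x₀, v) * taaN w₀ s y N (insert v X) := by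
  have key := taaNEv_section w w₀ y N x₀ v (insert s X) (Set.mem_insert_of_mem _ hx₀) he0 hoff
  rw [Set.insert_comm] at key
  simpa only [taaN] using key

/-! ### Degenerate cases -/

/-- If `y ∈ X` then `A^N = 0`. [folklore] -/
theorem taAN_eq_zero_of_mem (w : Sym2 V → ℝ) (s y : V) (N : Set V) (hsy : s ≠ y) (X : Set V) (hy : y ∈ X)
    (g : Set (Sym2 V) → ℝ) : taAN w s y N X g = 0 :=
  Finset.sum_eq_zero fun ω _ => by rw [taC_eq_zero_of_mem w s y hsy X hy g ω]; ring

/-- If `y ∈ X ∪ {s}` then `a^N = 0`. [folklore] -/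
theorem taaN_eq_zero_of_mem (w : Sym2 V → ℝ) (s y : V) (N : Set V) (X : Set V) (hy : y ∈ insert s X) :
    taaN w s y N X = 0 :=
  Finset.sum_eq_zero fun ω _ => by
    rw [ind_of_not_mem fun h => (h.1 : ∀ t ∈ insert s X, ¬ (openGraph ω).Reachable y t) y hy
      (SimpleGraph.Reachable.refl _), mul_zero]

/-- If `s ∈ X` then `A^N = 0`. [folklore] -/
theorem taAN_eq_zero_of_root_mem (w : Sym2 V → ℝ) (s y : V) (N : Set V) (X : Set V) (hs : s ∈ X)
    (g : Set (Sym2 V) → ℝ) : taAN w s y N X g = 0 :=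
  Finset.sum_eq_zero fun ω _ => by
    rw [ind_of_not_mem fun h => (h : ∀ t ∈ X, ¬ (openGraph ω).Reachable s t) s hs (SimpleGraph.Reachable.refl _)]
    ring

/-! ### The base case -/

omit [Fintype V] in
/-- If some vertex of `N` lies in `X`, the set of pairs meeting `X` contains the loop at it. [folklore] -/
theorem ind_avoidCut_pairsMeeting_eq_zero {N X : Set V} {n : V} (hn : n ∈ N) (hnX : n ∈ X) :
    ind (avoidCut N) {e : Sym2 V | ∃ u ∈ e, u ∈ X} = 0 :=
  ind_of_not_mem fun hB => hB n hn ⟨n, Sym2.mem_mk_left _ _, hnX⟩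

omit [Fintype V] in
/-- If no vertex of `N` lies in `X`, the set of pairs meeting `X` contains no loop at `N`. [folklore] -/
theorem ind_avoidCut_pairsMeeting_eq_one {N X : Set V} (h : ∀ n ∈ N, n ∉ X) :
    ind (avoidCut N) {e : Sym2 V | ∃ u ∈ e, u ∈ X} = 1 := by
  refine ind_of_mem fun n hn hmem => ?_
  obtain ⟨u, hu, huX⟩ := hmem
  have : u = n := by
    rcases Sym2.mem_iff.1 hu with rfl | rfl <;> rfl
  exact h n hn (this ▸ huX)

/-- **Base case of the set-observer induction**: if every non-loop pair joining `X` to `V ∖ X` has weight `0`, then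
`Q^N = A^N·b − a^N·B = 0`. (cell memo prim-hp-7 HP7-MDLX-PROOF.md §5, set-observer form) [folklore] -/
theorem taQN_eq_zero_of_noBoundary (w : Sym2 V → ℝ) (hw0 : ∀ e, 0 ≤ w e) (hw1 : ∀ e, w e ≤ 1)
    (hm : ∑ ω, weight w ω = 1) (s y : V) (N : Set V) (hsy : s ≠ y) (X : Set V) (g : Set (Sym2 V) → ℝ)
    (hbd : ∀ e : Sym2 V, ¬ e.IsDiag → ∀ a ∈ e, ∀ b ∈ e, a ∈ X → b ∉ X → w e = 0) :
    taQN w s y N X g = 0 := by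
  classical
  by_cases hs : s ∈ X
  · simp only [taQN, taAN_eq_zero_of_root_mem w s y N X hs, taB_eq_zero_of_root_mem w s y X hs]; ring
  by_cases hyX : y ∈ X
  · simp only [taQN, tab_eq_zero_of_mem w s y X (Set.mem_insert_of_mem _ hyX),
      taaN_eq_zero_of_mem w s y N X (Set.mem_insert_of_mem _ hyX)]; ring
  have hnb : ∀ η : Set (Sym2 V), ∀ e ∈ η \ {e | w e = 0}, ¬ e.IsDiag → ∀ a ∈ e, ∀ b ∈ e, a ∈ X → b ∈ X := by
    intro η e he hd a ha b hb haX
    by_contra hbX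
    exact he.2 (hbd e hd a ha b hb haX hbX)
  have hcut : ∀ η : Set (Sym2 V), cut X (η \ {e | w e = 0}) = {e | ∃ u ∈ e, u ∈ X} :=
    fun η => cut_eq_of_noBoundary (hnb η)
  have hD : ∀ η : Set (Sym2 V), η \ {e | w e = 0} ∈ avoidEv s X := fun η x hx hsx =>
    hs (mem_of_reachable_of_noBoundary (hnb η) hx hsx.symm)
  set B₀ : Set (Sym2 V) := {e | ∃ u ∈ e, u ∈ X} with hB₀
  set c₀ : ℝ := delE w B₀ (fun η => g (openEdgeCluster η s) * ind (openConn s y) η) -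
    delE w B₀ (fun η => g (openEdgeCluster η s)) * delE w B₀ (ind (openConn s y)) with hc₀
  set n₀ : ℝ := delE w B₀ (ind (openConn s y : Set (BondConfig V))ᶜ) with hn₀
  set nw₀ : ℝ := ind (avoidCut N) B₀ *
    delE w B₀ (ind ((openConn s y : Set (BondConfig V))ᶜ ∩ (connS N y ∩ sepEv N {s}))) with hnw₀
  have hB : taB w s y X g = c₀ := by
    rw [taB, sum_weight_eq_sum_sdiff_zeros w]
    have h1 : ∀ η : Set (Sym2 V), weight w η * (fun ω => ind (avoidEv s X) ω * taC w s y X g ω) (η \ {e | w e = 0}) =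
        weight w η * c₀ := by
      intro η; simp only; rw [ind_of_mem (hD η), one_mul, taC, hcut η]
    rw [Finset.sum_congr rfl fun η _ => h1 η, ← Finset.sum_mul, hm, one_mul]
  have hA : taAN w s y N X g = nw₀ / n₀ * c₀ := by
    rw [taAN, sum_weight_eq_sum_sdiff_zeros w]
    have h1 : ∀ η : Set (Sym2 V), weight w η * (fun ω => ind (avoidEv s X) ω *
        (taNWN w s y N X ω / taN w s y X ω * taC w s y X g ω)) (η \ {e | w e = 0}) = weight w η * (nw₀ / n₀ * c₀) := by
      intro η; simp only; rw [ind_of_mem (hD η), one_mul, taC, taN, taNWN, hcut η]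
    rw [Finset.sum_congr rfl fun η _ => h1 η, ← Finset.sum_mul, hm, one_mul]
  have hconn : ∀ (η : Set (Sym2 V)) (a t : V), a ∉ X →
      ((openGraph ((η \ {e | w e = 0}) \ B₀)).Reachable a t ↔ (openGraph (η \ {e | w e = 0})).Reachable a t) :=
    fun η a t ha => reachable_sdiff_iff_of_noBoundary (hnb η) ha t
  have hE : ∀ η : Set (Sym2 V), ind (avoidEv y (insert s X)) (η \ {e | w e = 0}) =
      ind (openConn s y : Set (BondConfig V))ᶜ ((η \ {e | w e = 0}) \ B₀) := by
    intro η
    by_cases h : η \ {e | w e = 0} ∈ avoidEv y (insert s X)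
    · rw [ind_of_mem h, ind_of_mem]
      intro hsy'
      exact h s (Set.mem_insert _ _) (((hconn η y s hyX).1 (hsy' : (openGraph _).Reachable s y).symm))
    · rw [ind_of_not_mem h, ind_of_not_mem]
      intro hN
      apply h
      intro t ht hyt
      rcases Set.mem_insert_iff.1 ht with rfl | ht
      · exact hN (((hconn η y t hyX).2 hyt).symm : (openGraph _).Reachable t y)
      · exact hyX (mem_of_reachable_of_noBoundary (hnb η) ht hyt.symm)
  have hb : tab w s y X = n₀ := by
    rw [tab, sum_weight_eq_sum_sdiff_zeros w, hn₀, delE,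
      sum_weight_eq_sum_sdiff_zeros w (fun η => ind _ (η \ B₀))]
    exact Finset.sum_congr rfl fun η _ => by rw [hE η]
  -- the `N`-event
  have hEN : ∀ η : Set (Sym2 V), ind (avoidEv y (insert s X) ∩ (connS N y ∩ sepEv N (insert s X))) (η \ {e | w e = 0}) =
      ind (avoidCut N) B₀ *
        ind ((openConn s y : Set (BondConfig V))ᶜ ∩ (connS N y ∩ sepEv N {s})) ((η \ {e | w e = 0}) \ B₀) := by
    intro η
    by_cases hNX : ∃ n ∈ N, n ∈ X
    · obtain ⟨n, hn, hnX⟩ := hNX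
      have h0 : ind (avoidCut N) B₀ = 0 := by rw [hB₀]; exact ind_avoidCut_pairsMeeting_eq_zero hn hnX
      rw [h0, zero_mul]
      exact ind_of_not_mem fun h => h.2.2 n hn n (Set.mem_insert_of_mem _ hnX) (SimpleGraph.Reachable.refl _)
    · have h1 : ind (avoidCut N) B₀ = 1 := by
        rw [hB₀]; exact ind_avoidCut_pairsMeeting_eq_one fun n hn hnX => hNX ⟨n, hn, hnX⟩
      rw [h1, one_mul, ind_inter, ind_inter, ind_inter, ind_inter, hE η]
      have hNX' : ∀ n ∈ N, n ∉ X := fun n hn hnX => hNX ⟨n, hn, hnX⟩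
      congr 1
      congr 1
      · by_cases h : η \ {e | w e = 0} ∈ connS N y
        · obtain ⟨n, hn, hyn⟩ := h
          have h' : (η \ {e | w e = 0}) \ B₀ ∈ connS N y := ⟨n, hn, (hconn η y n hyX).2 hyn⟩
          rw [ind_of_mem (show η \ {e | w e = 0} ∈ connS N y from ⟨n, hn, hyn⟩), ind_of_mem h']
        · have h' : (η \ {e | w e = 0}) \ B₀ ∉ connS N y := by
            rintro ⟨n, hn, hyn⟩
            exact h ⟨n, hn, (hconn η y n hyX).1 hyn⟩
          rw [ind_of_not_mem h, ind_of_not_mem h']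
      · by_cases h : η \ {e | w e = 0} ∈ sepEv N (insert s X)
        · have h' : (η \ {e | w e = 0}) \ B₀ ∈ sepEv N {s} := by
            intro n hn t ht hnt
            rw [Set.mem_singleton_iff] at ht
            subst ht
            exact h n hn _ (Set.mem_insert _ _) ((hconn η n _ (hNX' n hn)).1 hnt)
          rw [ind_of_mem h, ind_of_mem h']
        · have h' : (η \ {e | w e = 0}) \ B₀ ∉ sepEv N {s} := by
            intro hh
            apply h
            intro n hn t ht hnt
            rcases Set.mem_insert_iff.1 ht with rfl | ht
            · exact hh n hn _ (Set.mem_singleton _) ((hconn η n _ (hNX' n hn)).2 hnt)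
            · exact hNX' n hn (mem_of_reachable_of_noBoundary (hnb η) ht hnt.symm)
          rw [ind_of_not_mem h, ind_of_not_mem h']
  have ha : taaN w s y N X = nw₀ := by
    rw [taaN, sum_weight_eq_sum_sdiff_zeros w, hnw₀, delE,
      sum_weight_eq_sum_sdiff_zeros w (fun η => ind _ (η \ B₀)), Finset.mul_sum]
    refine Finset.sum_congr rfl fun η _ => ?_
    rw [hEN η]; ring
  have hle : nw₀ ≤ n₀ := by
    have hI0 := ind_nonneg (avoidCut N) B₀
    have hI1 := ind_le_one (avoidCut N) B₀
    have hd0 : 0 ≤ delE w B₀ (ind ((openConn s y : Set (BondConfig V))ᶜ ∩ (connS N y ∩ sepEv N {s}))) := by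
      simp only [delE]
      exact Finset.sum_nonneg fun η _ => mul_nonneg (weight_nonneg hw0 hw1 η) (ind_nonneg _ _)
    have hd1 : delE w B₀ (ind ((openConn s y : Set (BondConfig V))ᶜ ∩ (connS N y ∩ sepEv N {s}))) ≤ n₀ := by
      simp only [hn₀, delE]
      refine Finset.sum_le_sum fun η _ => mul_le_mul_of_nonneg_left ?_ (weight_nonneg hw0 hw1 η)
      rw [ind_inter]
      have h1 := ind_le_one (connS N y ∩ sepEv N {s} : Set (Set (Sym2 V))) (η \ B₀)
      have h2 := ind_nonneg (openConn s y : Set (BondConfig V))ᶜ (η \ B₀)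
      nlinarith [ind_nonneg (connS N y ∩ sepEv N {s} : Set (Set (Sym2 V))) (η \ B₀)]
    calc nw₀ = ind (avoidCut N) B₀ * delE w B₀ (ind ((openConn s y : Set (BondConfig V))ᶜ ∩
          (connS N y ∩ sepEv N {s}))) := rfl
      _ ≤ 1 * n₀ := mul_le_mul hI1 hd1 hd0 zero_le_one
      _ = n₀ := one_mul _
  have hnw0 : 0 ≤ nw₀ := by
    refine mul_nonneg (ind_nonneg _ _) ?_
    simp only [delE]
    exact Finset.sum_nonneg fun η _ => mul_nonneg (weight_nonneg hw0 hw1 η) (ind_nonneg _ _)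
  rw [taQN, hA, hB, ha, hb]
  by_cases hn : n₀ = 0
  · have : nw₀ = 0 := le_antisymm (hn ▸ hle) hnw0
    rw [this, hn]; ring
  · field_simp
    ring



end TAN

end HullPort

end Summit.CriticalPhenomena.PercolationContinuityZ3.Theorems
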